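import Summits.ABC.ABC.Theses.IsogenyGlueCongruence
import Literature.NumberTheory.DiophantineGeometry.PastenValuationProducts
import Literature.NumberTheory.Automorphic.BrandtXi
import Literature.NumberTheory.DiophantineGeometry.PastenValuationProductsProofs
import Literature.NumberTheory.EllipticCurves.DegreeConjectureAbcMurtyProofs
import Literature.NumberTheory.EllipticCurves.PeterssonNormLowerBoundSqrtProofs
import Literature.NumberTheory.EllipticCurves.SilvermanHeightCovolumeProofs
import Literature.NumberTheory.EllipticCurves.DegreeConjectureAbcPrelims
import Literature.NumberTheory.EllipticCurves.SzpiroOfAbcProofs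
import Literature.NumberTheory.DiophantineGeometry.LocalReductionProofs
import Literature.NumberTheory.DiophantineGeometry.MinimalDiscriminantNormProofs

set_option linter.dupNamespace false

/-!
# Sketch — crux-ideate stmt-ABC-10895 (SharpDegreeOfPolyDegree), ideator 3, round 1

First lemmas of the idea card `oldforms-free-under-poly` (statements only; they must elaborate).
R := SharpDegreeOfPolyDegree = (PolyDegreeBound → SemistableDegreeConjecture).
-/

noncomputable section

namespace Summit.ABC.ABC.Cruxes.SharpDegreeOfPolyDegree.Sketch

open Summit.ABC.ABC.Theses.IsogenyGlueCongruence
open Literature.NumberTheory.EllipticCurves Literature.NumberTheory.EllipticCurves.ModularForms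
open Literature.NumberTheory.DiophantineGeometry
open WeierstrassCurve CongruenceSubgroup

/-- The antecedent of `R` (verbatim). -/
def PolyDegreeBound : Prop :=
  ∃ κ C : ℝ, ∀ (W : WeierstrassCurve ℚ) [W.IsElliptic] [W.IsGloballyMinimal]
    [NeZero (W.conductorNorm ℤ)], W.IsSemistable ℤ →
      ∃ D : ModularParametrizationData W (W.conductorNorm ℤ),
        (D.modularDegree : ℝ) ≤ C * (W.conductorNorm ℤ : ℝ) ^ κ

/-- (L0) Single-valuation bound under Poly: every exponent of the minimal discriminant of a
semistable curve is `O(log N)`.  Route: Poly + Petersson lower bound ⟹ Zagier ⟹ covol ≥ K N^{-e}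
⟹ Silverman ⟹ `|Δ_min| ≤ A N^{6κ'}` (the exponent-tracking form of `Disproof.abs_disc_le_core`)
⟹ `v_p(Δ) log p ≤ log |Δ_min|`. -/
def ValuationLogBoundUnderPoly : Prop :=
  PolyDegreeBound → PeterssonLowerBound →
    ∃ A : ℝ, ∀ (W : WeierstrassCurve ℚ) [W.IsElliptic] [W.IsGloballyMinimal]
      [NeZero (W.conductorNorm ℤ)], W.IsSemistable ℤ → ∀ p : ℕ, p.Prime →
        (((W.minimalDiscriminantNorm ℤ).factorization p : ℕ) : ℝ) * Real.log p ≤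
          A * Real.log (W.conductorNorm ℤ) + A

/-- (L1) FLATNESS under Poly — the by-product that discharges the Ribet–Takahashi factor:
`T(E) = ∏_{p ∣ N} v_p(Δ_min) ≤ C_ε N^ε` for every semistable `E`, GIVEN the antecedent of `R`
(and the route's analytic item).  Elementary from (L0)'s global form `Σ_p v_p log p ≤ A log N + A`:
`Σ_{p > L} log v_p ≤ (e log L)⁻¹ Σ_p v_p log p`, `Σ_{p ≤ L} log v_p ≤ π(L) log(A log N + A)`. -/
def FlatnessUnderPoly : Prop :=
  PolyDegreeBound → PeterssonLowerBound →
    ∀ ε : ℝ, 0 < ε → ∃ C : ℝ, ∀ (W : WeierstrassCurve ℚ) [W.IsElliptic] [W.IsGloballyMinimal]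
      [NeZero (W.conductorNorm ℤ)], W.IsSemistable ℤ →
        (valuationProduct W : ℝ) ≤ C * (W.conductorNorm ℤ : ℝ) ^ ε

/-- (C⁺) TRANSFER TARGET — the sharp DEFINITE congruence number under Poly: for a semistable `E`
of conductor `N` and one odd prime `q ∣ N`, the Pollack–Weston / Gross congruence number
`ξ(E; N/q, q) = brandtXi (N/q) q (a_n(E))` (squared norm of the primitive integral Hecke
eigenvector in the Brandt module of discriminant `q`, level `N/q`) is `≤ C_ε N^{2+ε}`. -/
def XiSharpUnderPoly : Prop :=
  PolyDegreeBound →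
    ∀ ε : ℝ, 0 < ε → ∃ C : ℝ, ∀ (W : WeierstrassCurve ℚ) [W.IsElliptic] [W.IsGloballyMinimal]
      [NeZero (W.conductorNorm ℤ)], W.IsSemistable ℤ → ∀ q : ℕ, q.Prime → q ≠ 2 →
        q ∣ W.conductorNorm ℤ →
          (Literature.NumberTheory.Automorphic.brandtXi (W.conductorNorm ℤ / q) q
              (fun n => W.LFunction n) : ℝ) ≤ C * (W.conductorNorm ℤ : ℝ) ^ (2 + ε)

/-- (RT_ss) The definite Ribet–Takahashi comparison in the semistable form the reduction consumes
(upper-bound direction; KNOWN in print: Takahashi 2001 Thm 2.3 + 3.8, Pollack–Weston 2011 Thm 6.8,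
Eisenstein cokernel bounded by Mazur; the Frey-curve form is `DefiniteXi.DefiniteRTControlPrime`,
backed by the tree theorem `modularDegree_le_brandtXi_mul`): a minimal-degree datum satisfies
`deg ≤ C_ε N^ε · ξ(E; N/q, q) · v_q(Δ_min)`. -/
def DefiniteRTControlSemistable : Prop :=
  ∀ ε : ℝ, 0 < ε → ∃ C : ℝ, ∀ (W : WeierstrassCurve ℚ) [W.IsElliptic] [W.IsGloballyMinimal]
    [NeZero (W.conductorNorm ℤ)], W.IsSemistable ℤ → ∀ q : ℕ, q.Prime → q ≠ 2 →
      q ∣ W.conductorNorm ℤ → ∀ D : ModularParametrizationData W (W.conductorNorm ℤ),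
        (∀ D' : ModularParametrizationData W (W.conductorNorm ℤ), D.modularDegree ≤ D'.modularDegree) →
          (D.modularDegree : ℝ) ≤ C * (W.conductorNorm ℤ : ℝ) ^ ε *
            ((Literature.NumberTheory.Automorphic.brandtXi (W.conductorNorm ℤ / q) q
                (fun n => W.LFunction n) : ℝ) *
              (((W.minimalDiscriminantNorm ℤ).factorization q : ℕ) : ℝ))

/-- (RED) The reduction that makes the card a line for `R`:
transfer target + single-valuation bound + definite RT comparison + Petersson + modularity
(a datum exists, so a minimal one exists) ⟹ `R`.  Bookkeeping: deg_min ≤ C N^ε · C' N^{2+ε} ·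
(A log N + A)/log 3 ≤ C'' N^{2+3ε}. -/
def Reduction : Prop :=
  XiSharpUnderPoly → ValuationLogBoundUnderPoly → DefiniteRTControlSemistable →
    PeterssonLowerBound → SharpDegreeOfPolyDegree

/-- Sanity: the antecedent named here is the antecedent of the route decl. -/
theorem polyDegreeBound_iff :
    PolyDegreeBound ↔
      (∃ κ C : ℝ, ∀ (W : WeierstrassCurve ℚ) [W.IsElliptic] [W.IsGloballyMinimal]
        [NeZero (W.conductorNorm ℤ)], W.IsSemistable ℤ →
          ∃ D : ModularParametrizationData W (W.conductorNorm ℤ),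
            (D.modularDegree : ℝ) ≤ C * (W.conductorNorm ℤ : ℝ) ^ κ) := Iff.rfl

/-- Sanity: `R` is `PolyDegreeBound → X`. -/
theorem crux_iff : SharpDegreeOfPolyDegree ↔ (PolyDegreeBound → SemistableDegreeConjecture) :=
  Iff.rfl

/-! ## Poly ⟹ polynomial Szpiro ⟹ (L0), proved -/

/-- Exponent-tracking form of `Disproof.abs_disc_le_core`: a degree bound `deg ≤ C N^κ` with a
Petersson lower bound of exponent `η` and Silverman's inequality with exponent `6 + ε_S` gives
`|Δ_W| ≤ max(A,0) K^{-(6+ε_S)} N^m`, `m = (κ − 1 + η)(6 + ε_S)`. [cite: MurtyCongruencePrimes1999, §2] -/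
theorem abs_disc_le_core_exp {κ η e εS m c₂ C C₁ K A : ℝ}
    (he : e = κ - 1 + η) (hprod : (-e) * (-(6 + εS)) = m) (hεS : 0 < εS)
    (hC₁ : C ≤ C₁) (hC₁0 : 0 < C₁) (hK : K = 4 * Real.pi ^ 2 * c₂ / C₁) (hK0 : 0 < K)
    (hPc : ∀ (N : ℕ) [NeZero N] (W : WeierstrassCurve ℚ) [W.IsElliptic]
      (D : ModularParametrizationData W N),
        c₂ * (N : ℝ) ^ (1 - η) ≤ (peterssonProduct (Gamma0 N) 2 D.f D.f).re)
    (hA : ∀ (W : WeierstrassCurve ℚ) [W.IsElliptic] [W.IsGloballyMinimal]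
      (L : PeriodPair), IsNeronLatticeOf (W.baseChange ℂ) L →
        ((max |W.Δ| (|W.c₄| ^ 3) : ℚ) : ℝ) ≤ A * ZLattice.covolume L.lattice ^ (-(6 + εS)))
    (W : WeierstrassCurve ℚ) [W.IsElliptic] [W.IsGloballyMinimal] {N : ℕ} [NeZero N]
    (D : ModularParametrizationData W N)
    (hD : (D.modularDegree : ℝ) ≤ C * (N : ℝ) ^ κ) :
    ((|W.Δ| : ℚ) : ℝ) ≤ max A 0 * K ^ (-(6 + εS)) * (N : ℝ) ^ m := by
  have hN0 : (0 : ℝ) < N := by exact_mod_cast Nat.pos_of_ne_zero (NeZero.ne N)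
  have hZ := congrArg Complex.re D.zagier_degree_formula_holds
  rw [Complex.re_ofReal_mul, Complex.ofReal_re] at hZ
  have hc0 : D.maninConstant ≠ 0 := D.maninConstant_ne_zero_holds
  have hc : (D.c : ℝ) ≠ 0 := by exact_mod_cast hc0
  have hcov : 0 < ZLattice.covolume D.L.lattice := ZLattice.covolume_pos _ _
  have hc2 : (1 : ℝ) ≤ (D.c : ℝ) ^ 2 := by
    have h1 : (1 : ℤ) ≤ |D.c| := Int.one_le_abs hc0
    have h2 : (1 : ℝ) ≤ |(D.c : ℝ)| := by exact_mod_cast h1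
    calc (1 : ℝ) = 1 ^ 2 := by norm_num
      _ ≤ |(D.c : ℝ)| ^ 2 := pow_le_pow_left₀ zero_le_one h2 2
      _ = (D.c : ℝ) ^ 2 := sq_abs _
  have hdeg : (D.deg : ℝ) ≤ C₁ * (D.c : ℝ) ^ 2 * (N : ℝ) ^ (2 + (κ - 2)) := by
    have h2 : (2 : ℝ) + (κ - 2) = κ := by ring
    rw [h2]
    have hNκ : (0 : ℝ) ≤ (N : ℝ) ^ κ := Real.rpow_nonneg hN0.le _
    calc (D.deg : ℝ) = (D.modularDegree : ℝ) := rfl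
      _ ≤ C * (N : ℝ) ^ κ := hD
      _ ≤ C₁ * (N : ℝ) ^ κ := mul_le_mul_of_nonneg_right hC₁ hNκ
      _ = C₁ * 1 * (N : ℝ) ^ κ := by ring
      _ ≤ C₁ * (D.c : ℝ) ^ 2 * (N : ℝ) ^ κ := by gcongr
  have hPD := hPc N W D
  have hlow := covolume_ge_of_zagier_exp hN0 hC₁0 hc hcov hZ hdeg hPD
  have hexp : -(1 + (κ - 2) + η) = -e := by rw [he]; ring
  rw [hexp, ← hK] at hlow
  have hKN : 0 < K * (N : ℝ) ^ (-e) := mul_pos hK0 (Real.rpow_pos_of_pos hN0 _)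
  have hS := hA W D.L D.isNeronLattice
  have h1 : ((|W.Δ| : ℚ) : ℝ) ≤ ((max |W.Δ| (|W.c₄| ^ 3) : ℚ) : ℝ) :=
    Rat.cast_le.mpr (le_max_left _ _)
  have h3 : (K * (N : ℝ) ^ (-e)) ^ (-(6 + εS)) = K ^ (-(6 + εS)) * (N : ℝ) ^ m := by
    rw [Real.mul_rpow hK0.le (Real.rpow_nonneg hN0.le _), ← Real.rpow_mul hN0.le, hprod]
  have h2 : ∀ x : ℝ, K * (N : ℝ) ^ (-e) ≤ x →
      A * x ^ (-(6 + εS)) ≤ max A 0 * K ^ (-(6 + εS)) * (N : ℝ) ^ m := by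
    intro x hx
    have hx0 : 0 < x := hKN.trans_le hx
    calc A * x ^ (-(6 + εS)) ≤ max A 0 * x ^ (-(6 + εS)) :=
          mul_le_mul_of_nonneg_right (le_max_left _ _) (Real.rpow_nonneg hx0.le _)
      _ ≤ max A 0 * (K * (N : ℝ) ^ (-e)) ^ (-(6 + εS)) := by
          apply mul_le_mul_of_nonneg_left _ (le_max_right _ _)
          exact Real.rpow_le_rpow_of_nonpos hKN hx (by linarith)
      _ = max A 0 * K ^ (-(6 + εS)) * (N : ℝ) ^ m := by rw [h3]; ring
  exact h1.trans (hS.trans (h2 _ hlow))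

/-- Transport to a global minimal model (copy of `Disproof.exists_globallyMinimal_model`; Silverman
AEC VIII.8.3 over the PID `ℤ`, all tree theorems). [cite: SilvermanAEC2009, VIII.8 Cor. 8.3] -/
theorem exists_globallyMinimal_model' (W : WeierstrassCurve ℚ) [W.IsElliptic] :
    ∃ W₁ : WeierstrassCurve ℚ, W₁.IsElliptic ∧ W₁.IsGloballyMinimal ∧
      (W.IsSemistable ℤ → W₁.IsSemistable ℤ) ∧ W₁.conductorNorm ℤ = W.conductorNorm ℤ ∧
      ((|W₁.Δ| : ℚ) : ℝ) = (W.minimalDiscriminantNorm ℤ : ℝ) := by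
  obtain ⟨Cv, W₀, hCW, hmin⟩ := W.exists_baseChange_int_forall_isMinimalAt
  have hΔ0 : W₀.Δ ≠ 0 := by
    intro h0
    have h1 : (Cv • W).Δ = 0 := by
      simp [hCW, WeierstrassCurve.baseChange, WeierstrassCurve.map_Δ, h0]
    exact (Cv • W).isUnit_Δ.ne_zero h1
  haveI hE₁ : (W₀.baseChange ℚ).IsElliptic := isElliptic_baseChange_int W₀ hΔ0
  haveI hM₁ : (W₀.baseChange ℚ).IsGloballyMinimal :=
    isGloballyMinimal_of_forall_isMinimalAt_int _ hmin
  refine ⟨W₀.baseChange ℚ, hE₁, hM₁, fun hss => ?_, ?_, ?_⟩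
  · rw [← hCW]
    exact (isSemistable_smul_iff_holds ℤ W Cv).mpr hss
  · rw [← hCW, conductorNorm_smul_rat]
  · have hD₁ : W.minimalDiscriminantNorm ℤ = W₀.Δ.natAbs := by
      rw [← minimalDiscriminantNorm_smul_rat W Cv, hCW,
        minimalDiscriminantNorm_eq_natAbs_holds W₀ hΔ0 hmin]
    have hΔ : (W₀.baseChange ℚ).Δ = (W₀.Δ : ℚ) := by
      simp [WeierstrassCurve.baseChange, WeierstrassCurve.map_Δ]
    rw [hD₁, hΔ, Nat.cast_natAbs]
    push_cast
    rfl

/-- **Poly ⟹ polynomial Szpiro, UNCONDITIONALLY** (Iwaniec's elementary `(f,f) ≫ N^{1/2−δ}`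
suffices; the route's Petersson item is not needed): `|Δ_min(E)| ≤ A' · N_E^m` for every
semistable `E/ℚ`, with `m = 7(max κ 2 − 1/4)`. -/
theorem polySzpiro_of_poly (hPoly : PolyDegreeBound) :
    ∃ m A' : ℝ, 0 ≤ m ∧ ∀ (W : WeierstrassCurve ℚ) [W.IsElliptic], W.IsSemistable ℤ →
      (W.minimalDiscriminantNorm ℤ : ℝ) ≤ A' * (W.conductorNorm ℤ : ℝ) ^ m := by
  obtain ⟨κ, C, hC⟩ := hPoly
  -- Petersson lower bound with η = 3/4 (unconditional)
  obtain ⟨c₂, _, hPc⟩ :=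
    (HoffsteinLockhart1994_peterssonProduct_lower_bound_of_half_lt (ε := (3 : ℝ) / 4) (by norm_num))
  set κ' : ℝ := max κ 2 with hκ'
  obtain ⟨e, he⟩ : ∃ e : ℝ, e = κ' - 1 + 3 / 4 := ⟨_, rfl⟩
  have he0 : 0 < e := by
    rw [he]; have := le_max_right κ 2; linarith
  obtain ⟨A, hA⟩ := silverman1986_discriminant_c4_covolume_holds 1 one_pos
  have hC₁0 : 0 < max C 1 := lt_of_lt_of_le one_pos (le_max_right _ _)
  obtain ⟨K, hK⟩ : ∃ K : ℝ, K = 4 * Real.pi ^ 2 * c₂ / max C 1 := ⟨_, rfl⟩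
  have hK0 : 0 < K := by rw [hK]; positivity
  have hprod : (-e) * (-(6 + (1 : ℝ))) = 7 * e := by ring
  refine ⟨7 * e, max A 0 * K ^ (-(6 + (1 : ℝ))), by linarith, fun W _ hss => ?_⟩
  obtain ⟨W₁, hE₁, hM₁, hss₁, hN₁, hΔ₁⟩ := exists_globallyMinimal_model' W
  haveI := hE₁
  haveI := hM₁
  have hNpos : 0 < W₁.conductorNorm ℤ := conductorNorm_pos_holds W₁
  haveI : NeZero (W₁.conductorNorm ℤ) := ⟨hNpos.ne'⟩
  obtain ⟨D, hD⟩ := hC W₁ (hss₁ hss)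
  -- move the exponent up to κ' and the constant up to max C 1
  have hN1 : (1 : ℝ) ≤ (W₁.conductorNorm ℤ : ℝ) := by exact_mod_cast hNpos
  have hD' : (D.modularDegree : ℝ) ≤ max C 1 * (W₁.conductorNorm ℤ : ℝ) ^ κ' := by
    calc (D.modularDegree : ℝ) ≤ C * (W₁.conductorNorm ℤ : ℝ) ^ κ := hD
      _ ≤ max C 1 * (W₁.conductorNorm ℤ : ℝ) ^ κ :=
          mul_le_mul_of_nonneg_right (le_max_left _ _) (Real.rpow_nonneg (by linarith) _)
      _ ≤ max C 1 * (W₁.conductorNorm ℤ : ℝ) ^ κ' :=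
          mul_le_mul_of_nonneg_left (Real.rpow_le_rpow_of_exponent_le hN1 (le_max_left _ _))
            hC₁0.le
  have := abs_disc_le_core_exp he hprod one_pos le_rfl hC₁0 hK hK0 hPc hA W₁ D hD'
  rw [hΔ₁, hN₁] at this
  exact this

/-- **(L0) holds** — even without the Petersson item. -/
theorem valuationLogBoundUnderPoly_holds : ValuationLogBoundUnderPoly := by
  intro hPoly _
  obtain ⟨m, A', hm, h⟩ := polySzpiro_of_poly hPoly
  refine ⟨max (Real.log (max A' 1)) m, fun W _ _ _ hss p hp => ?_⟩
  have hΔpos : 0 < W.minimalDiscriminantNorm ℤ := minimalDiscriminantNorm_pos_holds W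
  have hNpos : 0 < W.conductorNorm ℤ := Nat.pos_of_ne_zero (NeZero.ne _)
  have hN1 : (1 : ℝ) ≤ (W.conductorNorm ℤ : ℝ) := by exact_mod_cast hNpos
  have hlogN : 0 ≤ Real.log (W.conductorNorm ℤ : ℝ) := Real.log_nonneg hN1
  -- p^{v_p} ≤ Δ_min
  have hdvd : p ^ (W.minimalDiscriminantNorm ℤ).factorization p ∣ W.minimalDiscriminantNorm ℤ :=
    Nat.ordProj_dvd _ _
  have hle : (p : ℝ) ^ (W.minimalDiscriminantNorm ℤ).factorization p ≤ (W.minimalDiscriminantNorm ℤ : ℝ) := by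
    exact_mod_cast Nat.le_of_dvd hΔpos hdvd
  have hp0 : (0 : ℝ) < p := by exact_mod_cast hp.pos
  have h1 : (((W.minimalDiscriminantNorm ℤ).factorization p : ℕ) : ℝ) * Real.log p ≤
      Real.log (W.minimalDiscriminantNorm ℤ : ℝ) := by
    rw [← Real.log_pow]
    exact Real.log_le_log (pow_pos hp0 _) hle
  -- Δ_min ≤ max A' 1 · N^m
  have h2 : (W.minimalDiscriminantNorm ℤ : ℝ) ≤ max A' 1 * (W.conductorNorm ℤ : ℝ) ^ m :=
    (h W hss).trans (mul_le_mul_of_nonneg_right (le_max_left _ _) (Real.rpow_nonneg (by linarith) _))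
  have hΔr : (0 : ℝ) < (W.minimalDiscriminantNorm ℤ : ℝ) := by exact_mod_cast hΔpos
  have h3 : Real.log (W.minimalDiscriminantNorm ℤ : ℝ) ≤
      Real.log (max A' 1) + m * Real.log (W.conductorNorm ℤ : ℝ) := by
    have hpos : 0 < max A' 1 * (W.conductorNorm ℤ : ℝ) ^ m :=
      mul_pos (lt_of_lt_of_le one_pos (le_max_right _ _)) (Real.rpow_pos_of_pos (by linarith) _)
    calc Real.log (W.minimalDiscriminantNorm ℤ : ℝ) ≤ Real.log (max A' 1 * (W.conductorNorm ℤ : ℝ) ^ m) :=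
          Real.log_le_log hΔr h2
      _ = Real.log (max A' 1) + m * Real.log (W.conductorNorm ℤ : ℝ) := by
          rw [Real.log_mul (ne_of_gt (lt_of_lt_of_le one_pos (le_max_right _ _)))
            (ne_of_gt (Real.rpow_pos_of_pos (by linarith) _)), Real.log_rpow (by linarith)]
  calc (((W.minimalDiscriminantNorm ℤ).factorization p : ℕ) : ℝ) * Real.log p
        ≤ Real.log (max A' 1) + m * Real.log (W.conductorNorm ℤ : ℝ) := h1.trans h3
    _ ≤ max (Real.log (max A' 1)) m + max (Real.log (max A' 1)) m * Real.log (W.conductorNorm ℤ : ℝ) :=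
        add_le_add (le_max_left _ _) (mul_le_mul_of_nonneg_right (le_max_right _ _) hlogN)
    _ = max (Real.log (max A' 1)) m * Real.log (W.conductorNorm ℤ) + max (Real.log (max A' 1)) m := by
        push_cast; ring

/-! ## (L1) Flatness under Poly, proved -/

/-- For any finite set `T` of primes, `∏_{p ∈ T} p^{v_p(n)} ≤ n` (`n ≠ 0`). -/
theorem prod_pow_factorization_le {n : ℕ} (hn : n ≠ 0) (T : Finset ℕ)
    (hT : ∀ p ∈ T, p.Prime) : ∏ p ∈ T, p ^ n.factorization p ≤ n := by
  classical
  have h1 : ∏ p ∈ T, p ^ n.factorization p ≤ ∏ p ∈ T ∪ n.primeFactors, p ^ n.factorization p := by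
    apply Finset.prod_le_prod_of_subset_of_one_le' Finset.subset_union_left
    intro p hp _
    have hp' : p.Prime := by
      rcases Finset.mem_union.mp hp with h | h
      · exact hT p h
      · exact Nat.prime_of_mem_primeFactors h
    exact Nat.one_le_pow _ _ hp'.pos
  have h2 : ∏ p ∈ T ∪ n.primeFactors, p ^ n.factorization p = ∏ p ∈ n.primeFactors, p ^ n.factorization p := by
    symm
    apply Finset.prod_subset Finset.subset_union_right
    intro p _ hpn
    have : n.factorization p = 0 := by
      rw [← Nat.support_factorization] at hpn
      exact Finsupp.notMem_support_iff.mp hpn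
    rw [this, pow_zero]
  have h3 : ∏ p ∈ n.primeFactors, p ^ n.factorization p = n := by
    conv_rhs => rw [← Nat.factorization_prod_pow_eq_self hn]
    rw [Finsupp.prod, Nat.support_factorization]
  calc ∏ p ∈ T, p ^ n.factorization p ≤ ∏ p ∈ T ∪ n.primeFactors, p ^ n.factorization p := h1
    _ = n := by rw [h2, h3]

/-- Real form: `∏_{p ∈ T} (p : ℝ)^{v_p(n)} ≤ n`. -/
theorem prod_rpow_factorization_le {n : ℕ} (hn : n ≠ 0) (T : Finset ℕ)
    (hT : ∀ p ∈ T, p.Prime) : ∏ p ∈ T, ((p : ℝ) ^ (n.factorization p : ℕ)) ≤ (n : ℝ) := by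
  have := prod_pow_factorization_le hn T hT
  exact_mod_cast this

/-- Single valuation: `v_p(n) · log p ≤ log n`. -/
theorem factorization_mul_log_le {n : ℕ} (hn : n ≠ 0) {p : ℕ} (hp : p.Prime) :
    ((n.factorization p : ℕ) : ℝ) * Real.log p ≤ Real.log n := by
  have hdvd : p ^ n.factorization p ∣ n := Nat.ordProj_dvd _ _
  have hle : (p : ℝ) ^ n.factorization p ≤ (n : ℝ) := by
    exact_mod_cast Nat.le_of_dvd (Nat.pos_of_ne_zero hn) hdvd
  have hp0 : (0 : ℝ) < p := by exact_mod_cast hp.pos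
  rw [← Real.log_pow]
  exact Real.log_le_log (pow_pos hp0 _) hle

/-- **(L1) holds**: under Poly, `T(E) = ∏_{p ∣ N} v_p(Δ_min) ≤ C_ε N^ε` — the Ribet–Takahashi
factor is negligible (the semistable case of `RibetTakahashiSplit.Many/FewPrimeValuationProduct`
follows from the antecedent of `R`). -/
theorem flatnessUnderPoly_holds : FlatnessUnderPoly := by
  intro hPoly _ ε hε
  obtain ⟨m, A', hm, hSz⟩ := polySzpiro_of_poly hPoly
  -- parameters
  set L : ℕ := ⌈Real.exp (2 * m / ε)⌉₊ + 3 with hLdef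
  have hL3 : (3 : ℝ) ≤ L := by
    have : 3 ≤ L := by omega
    exact_mod_cast this
  have hLexp : Real.exp (2 * m / ε) ≤ L := by
    have h1 : Real.exp (2 * m / ε) ≤ ⌈Real.exp (2 * m / ε)⌉₊ := Nat.le_ceil _
    have h2 : (⌈Real.exp (2 * m / ε)⌉₊ : ℝ) ≤ L := by
      rw [hLdef]; push_cast; linarith
    linarith
  have hlogL : 1 ≤ Real.log L := by
    rw [Real.le_log_iff_exp_le (by linarith)]
    have := Real.exp_one_lt_d9; linarith
  have hlogL0 : 0 < Real.log L := by linarith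
  set θ : ℝ := 1 / Real.log L with hθ
  have hθ0 : 0 < θ := by positivity
  have hθL : θ * Real.log L = 1 := by rw [hθ]; field_simp
  have hmθ : m * θ ≤ ε / 2 := by
    -- log L ≥ 2m/ε
    have h1 : 2 * m / ε ≤ Real.log L := by
      have := Real.log_le_log (Real.exp_pos _) hLexp
      rwa [Real.log_exp] at this
    rw [hθ]
    rw [mul_one_div, div_le_iff₀ hlogL0]
    calc m = (2 * m / ε) * (ε / 2) := by field_simp
      _ ≤ Real.log L * (ε / 2) := mul_le_mul_of_nonneg_right h1 (by linarith)
      _ = ε / 2 * Real.log L := by ring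
  set δ : ℝ := ε / (2 * ((L : ℝ) + 1)) with hδ
  have hδ0 : 0 < δ := by positivity
  have hδL : δ * ((L : ℝ) + 1) = ε / 2 := by rw [hδ]; field_simp
  set B : ℝ := Real.log (max A' 1) with hB
  have hB0 : 0 ≤ B := Real.log_nonneg (le_max_right _ _)
  have hlog2 : 0 < Real.log 2 := Real.log_pos (by norm_num)
  set K₁ : ℝ := 1 + B / Real.log 2 + m / (δ * Real.log 2) with hK₁
  have hK₁1 : 1 ≤ K₁ := by
    rw [hK₁]
    have : 0 ≤ B / Real.log 2 := by positivity
    have : 0 ≤ m / (δ * Real.log 2) := by positivity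
    linarith
  have hA1 : 1 ≤ max A' 1 := le_max_right _ _
  refine ⟨K₁ ^ (L + 1) * (max A' 1) ^ θ, ?_⟩
  intro W _ _ _ hss
  -- basic facts about N and Δ
  have hNpos : 0 < W.conductorNorm ℤ := Nat.pos_of_ne_zero (NeZero.ne _)
  have hN1 : (1 : ℝ) ≤ (W.conductorNorm ℤ : ℝ) := by exact_mod_cast hNpos
  have hN0 : (0 : ℝ) < (W.conductorNorm ℤ : ℝ) := by linarith
  have hΔpos : 0 < W.minimalDiscriminantNorm ℤ := minimalDiscriminantNorm_pos_holds W
  have hΔ0 : W.minimalDiscriminantNorm ℤ ≠ 0 := hΔpos.ne'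
  have hΔr : (0 : ℝ) < (W.minimalDiscriminantNorm ℤ : ℝ) := by exact_mod_cast hΔpos
  have hΔle : (W.minimalDiscriminantNorm ℤ : ℝ) ≤ max A' 1 * (W.conductorNorm ℤ : ℝ) ^ m :=
    (hSz W hss).trans (mul_le_mul_of_nonneg_right (le_max_left _ _) (Real.rpow_nonneg hN0.le _))
  have hlogΔ : Real.log (W.minimalDiscriminantNorm ℤ : ℝ) ≤ B + m * Real.log (W.conductorNorm ℤ : ℝ) := by
    have hpos : 0 < max A' 1 * (W.conductorNorm ℤ : ℝ) ^ m :=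
      mul_pos (lt_of_lt_of_le one_pos hA1) (Real.rpow_pos_of_pos hN0 _)
    calc Real.log (W.minimalDiscriminantNorm ℤ : ℝ)
          ≤ Real.log (max A' 1 * (W.conductorNorm ℤ : ℝ) ^ m) := Real.log_le_log hΔr hΔle
      _ = B + m * Real.log (W.conductorNorm ℤ : ℝ) := by
          rw [hB, Real.log_mul (ne_of_gt (lt_of_lt_of_le one_pos hA1))
            (ne_of_gt (Real.rpow_pos_of_pos hN0 _)), Real.log_rpow hN0]
  have hlogN : 0 ≤ Real.log (W.conductorNorm ℤ : ℝ) := Real.log_nonneg hN1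
  have hlogNδ : Real.log (W.conductorNorm ℤ : ℝ) ≤ (W.conductorNorm ℤ : ℝ) ^ δ / δ :=
    Real.log_le_rpow_div hN0.le hδ0
  have hNδ1 : 1 ≤ (W.conductorNorm ℤ : ℝ) ^ δ := Real.one_le_rpow hN1 hδ0.le
  -- split the product
  classical
  set S := (W.conductorNorm ℤ).primeFactors with hS
  set v : ℕ → ℕ := fun p => (W.minimalDiscriminantNorm ℤ).factorization p with hv
  have hsplit : (valuationProduct W : ℝ) =
      (∏ p ∈ S.filter (fun p => p ≤ L), (v p : ℝ)) * (∏ p ∈ S.filter (fun p => ¬ p ≤ L), (v p : ℝ)) := by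
    rw [valuationProduct_def, ← Finset.prod_filter_mul_prod_filter_not S (fun p => p ≤ L)]
    push_cast
    rfl
  -- pointwise bound on every valuation
  have hvle : ∀ p ∈ S, (v p : ℝ) ≤ (B + m * Real.log (W.conductorNorm ℤ : ℝ)) / Real.log 2 := by
    intro p hp
    have hpp : p.Prime := Nat.prime_of_mem_primeFactors hp
    have h1 := factorization_mul_log_le hΔ0 hpp
    have hlogp : Real.log 2 ≤ Real.log p :=
      Real.log_le_log (by norm_num) (by exact_mod_cast hpp.two_le)
    rw [le_div_iff₀ hlog2]
    calc (v p : ℝ) * Real.log 2 ≤ (v p : ℝ) * Real.log p :=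
          mul_le_mul_of_nonneg_left hlogp (Nat.cast_nonneg _)
      _ ≤ Real.log (W.minimalDiscriminantNorm ℤ : ℝ) := h1
      _ ≤ B + m * Real.log (W.conductorNorm ℤ : ℝ) := hlogΔ
  -- (A) small primes
  have hV : (B + m * Real.log (W.conductorNorm ℤ : ℝ)) / Real.log 2 ≤ K₁ * (W.conductorNorm ℤ : ℝ) ^ δ := by
    rw [div_le_iff₀ hlog2, hK₁]
    have h1 : m * Real.log (W.conductorNorm ℤ : ℝ) ≤ m * ((W.conductorNorm ℤ : ℝ) ^ δ / δ) :=
      mul_le_mul_of_nonneg_left hlogNδ hm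
    have h2 : B ≤ B * (W.conductorNorm ℤ : ℝ) ^ δ := le_mul_of_one_le_right hB0 hNδ1
    have h3 : 0 ≤ (W.conductorNorm ℤ : ℝ) ^ δ := by linarith
    have h4 : (1 + B / Real.log 2 + m / (δ * Real.log 2)) * (W.conductorNorm ℤ : ℝ) ^ δ * Real.log 2
        = Real.log 2 * (W.conductorNorm ℤ : ℝ) ^ δ + B * (W.conductorNorm ℤ : ℝ) ^ δ
          + m * ((W.conductorNorm ℤ : ℝ) ^ δ / δ) := by
      field_simp
    rw [h4]
    nlinarith [mul_nonneg hlog2.le h3]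
  have hA_ : ∏ p ∈ S.filter (fun p => p ≤ L), (v p : ℝ) ≤ K₁ ^ (L + 1) * (W.conductorNorm ℤ : ℝ) ^ (ε / 2) := by
    have hcard : (S.filter (fun p => p ≤ L)).card ≤ L + 1 := by
      calc (S.filter (fun p => p ≤ L)).card ≤ (Finset.range (L + 1)).card := by
            apply Finset.card_le_card
            intro p hp
            rw [Finset.mem_filter] at hp
            exact Finset.mem_range.mpr (Nat.lt_succ_of_le hp.2)
        _ = L + 1 := Finset.card_range _
    have hX1 : 1 ≤ K₁ * (W.conductorNorm ℤ : ℝ) ^ δ := by nlinarith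
    calc ∏ p ∈ S.filter (fun p => p ≤ L), (v p : ℝ)
          ≤ ∏ p ∈ S.filter (fun p => p ≤ L), (K₁ * (W.conductorNorm ℤ : ℝ) ^ δ) := by
            apply Finset.prod_le_prod (fun p _ => Nat.cast_nonneg _)
            intro p hp
            exact ((hvle p (Finset.mem_filter.mp hp).1).trans hV)
      _ = (K₁ * (W.conductorNorm ℤ : ℝ) ^ δ) ^ (S.filter (fun p => p ≤ L)).card := Finset.prod_const _
      _ ≤ (K₁ * (W.conductorNorm ℤ : ℝ) ^ δ) ^ (L + 1) := pow_le_pow_right₀ hX1 hcard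
      _ = K₁ ^ (L + 1) * ((W.conductorNorm ℤ : ℝ) ^ δ) ^ (L + 1) := mul_pow _ _ _
      _ = K₁ ^ (L + 1) * (W.conductorNorm ℤ : ℝ) ^ (ε / 2) := by
            congr 1
            rw [← Real.rpow_natCast, ← Real.rpow_mul hN0.le]
            congr 1
            push_cast
            linarith [hδL]
  -- (B) large primes
  have hB_ : ∏ p ∈ S.filter (fun p => ¬ p ≤ L), (v p : ℝ) ≤ (max A' 1) ^ θ * (W.conductorNorm ℤ : ℝ) ^ (ε / 2) := by
    have hprime : ∀ p ∈ S.filter (fun p => ¬ p ≤ L), p.Prime :=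
      fun p hp => Nat.prime_of_mem_primeFactors (Finset.mem_filter.mp hp).1
    -- v_p ≤ (p^{v_p})^θ for p > L
    have hpt : ∀ p ∈ S.filter (fun p => ¬ p ≤ L), (v p : ℝ) ≤ ((p : ℝ) ^ (v p : ℕ)) ^ θ := by
      intro p hp
      have hpL : (L : ℝ) < p := by
        have := (Finset.mem_filter.mp hp).2
        push_neg at this
        exact_mod_cast this
      have hp0 : (0 : ℝ) < p := by linarith
      have hlogp : Real.log L ≤ Real.log p := Real.log_le_log (by linarith) hpL.le
      have h1 : (v p : ℝ) ≤ (v p : ℝ) * (θ * Real.log p) := by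
        have : 1 ≤ θ * Real.log p := by
          calc (1 : ℝ) = θ * Real.log L := hθL.symm
            _ ≤ θ * Real.log p := mul_le_mul_of_nonneg_left hlogp hθ0.le
        exact le_mul_of_one_le_right (Nat.cast_nonneg _) this
      calc (v p : ℝ) ≤ (v p : ℝ) * (θ * Real.log p) := h1
        _ ≤ (v p : ℝ) * (θ * Real.log p) + 1 := by linarith
        _ ≤ Real.exp ((v p : ℝ) * (θ * Real.log p)) := Real.add_one_le_exp _
        _ = ((p : ℝ) ^ (v p : ℕ)) ^ θ := by
            rw [← Real.rpow_natCast, ← Real.rpow_mul hp0.le, Real.rpow_def_of_pos hp0]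
            congr 1; ring
    have hnonneg : ∀ p ∈ S.filter (fun p => ¬ p ≤ L), (0 : ℝ) ≤ (p : ℝ) ^ (v p : ℕ) :=
      fun p _ => pow_nonneg (Nat.cast_nonneg _) _
    calc ∏ p ∈ S.filter (fun p => ¬ p ≤ L), (v p : ℝ)
          ≤ ∏ p ∈ S.filter (fun p => ¬ p ≤ L), ((p : ℝ) ^ (v p : ℕ)) ^ θ :=
            Finset.prod_le_prod (fun p _ => Nat.cast_nonneg _) hpt
      _ = (∏ p ∈ S.filter (fun p => ¬ p ≤ L), (p : ℝ) ^ (v p : ℕ)) ^ θ :=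
            Real.finset_prod_rpow _ _ hnonneg θ
      _ ≤ ((W.minimalDiscriminantNorm ℤ : ℕ) : ℝ) ^ θ :=
            Real.rpow_le_rpow (Finset.prod_nonneg hnonneg)
              (prod_rpow_factorization_le hΔ0 _ hprime) hθ0.le
      _ ≤ (max A' 1 * (W.conductorNorm ℤ : ℝ) ^ m) ^ θ :=
            Real.rpow_le_rpow hΔr.le hΔle hθ0.le
      _ = (max A' 1) ^ θ * (W.conductorNorm ℤ : ℝ) ^ (m * θ) := by
            rw [Real.mul_rpow (by linarith) (Real.rpow_nonneg hN0.le _), ← Real.rpow_mul hN0.le]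
      _ ≤ (max A' 1) ^ θ * (W.conductorNorm ℤ : ℝ) ^ (ε / 2) :=
            mul_le_mul_of_nonneg_left (Real.rpow_le_rpow_of_exponent_le hN1 hmθ)
              (Real.rpow_nonneg (by linarith) _)
  -- combine
  have hA0 : 0 ≤ ∏ p ∈ S.filter (fun p => p ≤ L), (v p : ℝ) := Finset.prod_nonneg (fun p _ => Nat.cast_nonneg _)
  have hB0' : 0 ≤ ∏ p ∈ S.filter (fun p => ¬ p ≤ L), (v p : ℝ) := Finset.prod_nonneg (fun p _ => Nat.cast_nonneg _)
  rw [hsplit]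
  calc (∏ p ∈ S.filter (fun p => p ≤ L), (v p : ℝ)) * (∏ p ∈ S.filter (fun p => ¬ p ≤ L), (v p : ℝ))
        ≤ (K₁ ^ (L + 1) * (W.conductorNorm ℤ : ℝ) ^ (ε / 2)) * ((max A' 1) ^ θ * (W.conductorNorm ℤ : ℝ) ^ (ε / 2)) :=
          mul_le_mul hA_ hB_ hB0' (by positivity)
    _ = K₁ ^ (L + 1) * (max A' 1) ^ θ * ((W.conductorNorm ℤ : ℝ) ^ (ε / 2) * (W.conductorNorm ℤ : ℝ) ^ (ε / 2)) := by ring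
    _ = K₁ ^ (L + 1) * (max A' 1) ^ θ * (W.conductorNorm ℤ : ℝ) ^ ε := by
          rw [← Real.rpow_add hN0]; ring_nf

/-! ## The reduction is provable now -/

/-- Conductors of semistable curves with no odd prime factor are `≤ 2`. -/
theorem conductorNorm_le_two_of_forall (W : WeierstrassCurve ℚ) [W.IsElliptic]
    (hss : W.IsSemistable ℤ) (h : ∀ q : ℕ, q.Prime → q ∣ W.conductorNorm ℤ → q = 2) :
    W.conductorNorm ℤ ≤ 2 := by
  have hsq : Squarefree (W.conductorNorm ℤ) := (W.isSemistable_iff_squarefree_conductorNorm).mp hss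
  have hN0 : W.conductorNorm ℤ ≠ 0 := hsq.ne_zero
  set k := (W.conductorNorm ℤ).primeFactorsList.length with hk
  have hpow : W.conductorNorm ℤ = 2 ^ k :=
    Nat.eq_prime_pow_of_unique_prime_dvd hN0 (fun {d} hd hdvd => h d hd hdvd)
  by_contra hlt
  push_neg at hlt
  have hk2 : 2 ≤ k := by
    by_contra hk1
    push_neg at hk1
    have hle : W.conductorNorm ℤ ≤ 2 := by
      rw [hpow]
      calc 2 ^ k ≤ 2 ^ 1 := Nat.pow_le_pow_right (by norm_num) (by omega)
        _ = 2 := by norm_num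
    omega
  have h4 : 2 * 2 ∣ W.conductorNorm ℤ := by
    rw [hpow]
    exact ⟨2 ^ (k - 2), by
      rw [show (2 : ℕ) * 2 = 2 ^ 2 by norm_num, ← pow_add, Nat.add_sub_cancel' hk2]⟩
  have := hsq 2 h4
  norm_num at this

/-- `(N : ℝ) ^ κ ≤ 2 ^ |κ|` when `1 ≤ N ≤ 2`. -/
theorem rpow_le_two_rpow_abs {N : ℝ} (h1 : 1 ≤ N) (h2 : N ≤ 2) (κ : ℝ) :
    N ^ κ ≤ (2 : ℝ) ^ |κ| := by
  rcases le_or_gt 0 κ with hκ | hκ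
  · calc N ^ κ ≤ (2 : ℝ) ^ κ := Real.rpow_le_rpow (by linarith) h2 hκ
      _ = (2 : ℝ) ^ |κ| := by rw [abs_of_nonneg hκ]
  · calc N ^ κ ≤ 1 := Real.rpow_le_one_of_one_le_of_nonpos h1 hκ.le
      _ ≤ (2 : ℝ) ^ |κ| := Real.one_le_rpow (by norm_num) (abs_nonneg κ)

/-- `log q ≥ 1` for an odd prime `q`. -/
theorem one_le_log_of_odd_prime {q : ℕ} (hq : q.Prime) (hq2 : q ≠ 2) : (1 : ℝ) ≤ Real.log q := by
  have hq3 : (3 : ℝ) ≤ q := by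
    have h2 := hq.two_le
    have : 3 ≤ q := by omega
    exact_mod_cast this
  have hqpos : (0 : ℝ) < q := by linarith
  rw [Real.le_log_iff_exp_le hqpos]
  have := Real.exp_one_lt_d9
  linarith

/-- `log N + 1 ≤ (3/ε + 1) · N^{ε/3}` for `N ≥ 1`, `ε > 0`. -/
theorem log_add_one_le {N ε : ℝ} (hN : 1 ≤ N) (hε : 0 < ε) :
    Real.log N + 1 ≤ (3 / ε + 1) * N ^ (ε / 3) := by
  have hε3 : 0 < ε / 3 := by positivity
  have h1 : Real.log N ≤ N ^ (ε / 3) / (ε / 3) := Real.log_le_rpow_div (by linarith) hε3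
  have h2 : (1 : ℝ) ≤ N ^ (ε / 3) := Real.one_le_rpow hN hε3.le
  have h3 : N ^ (ε / 3) / (ε / 3) = 3 / ε * N ^ (ε / 3) := by
    field_simp
  rw [h3] at h1
  nlinarith

/-- **RED holds**: the transfer target, the single-valuation bound and the definite
Ribet–Takahashi comparison (with the route's Petersson item) imply the crux `R`. -/
theorem reduction_holds : Reduction := by
  intro hXi hV hRT hP hPoly ε hε
  obtain ⟨κ, C₀, hC₀⟩ := id hPoly
  have hε3 : 0 < ε / 3 := by positivity
  obtain ⟨C₁, hC₁⟩ := hXi hPoly (ε / 3) hε3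
  obtain ⟨A, hA⟩ := hV hPoly hP
  obtain ⟨C₂, hC₂⟩ := hRT (ε / 3) hε3
  set K : ℝ := max C₂ 0 * (max C₁ 0 * (max A 0 * (3 / ε + 1))) with hK
  have hK0 : 0 ≤ K := by positivity
  refine ⟨max (max C₀ 0 * (2 : ℝ) ^ |κ|) K, ?_⟩
  intro W _ _ _ hss
  have hNpos : 0 < W.conductorNorm ℤ := Nat.pos_of_ne_zero (NeZero.ne _)
  have hN1 : (1 : ℝ) ≤ (W.conductorNorm ℤ : ℝ) := by exact_mod_cast hNpos
  have hN0 : (0 : ℝ) < (W.conductorNorm ℤ : ℝ) := by linarith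
  have hNε : (1 : ℝ) ≤ (W.conductorNorm ℤ : ℝ) ^ (2 + ε) := Real.one_le_rpow hN1 (by linarith)
  have hCle : K ≤ max (max C₀ 0 * (2 : ℝ) ^ |κ|) K := le_max_right _ _
  have hC0 : 0 ≤ max (max C₀ 0 * (2 : ℝ) ^ |κ|) K := le_trans hK0 hCle
  -- the datum supplied by Poly
  obtain ⟨D₀, hD₀⟩ := hC₀ W hss
  by_cases hodd : ∃ q : ℕ, q.Prime ∧ q ≠ 2 ∧ q ∣ W.conductorNorm ℤ
  · obtain ⟨q, hq, hq2, hqN⟩ := hodd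
    -- a minimal-degree datum exists
    classical
    have hne : ∃ d : ℕ, ∃ D : ModularParametrizationData W (W.conductorNorm ℤ),
        D.modularDegree = d := ⟨_, D₀, rfl⟩
    obtain ⟨D, hD⟩ := Nat.find_spec hne
    have hmin : ∀ D' : ModularParametrizationData W (W.conductorNorm ℤ),
        D.modularDegree ≤ D'.modularDegree := by
      intro D'
      rw [hD]
      exact Nat.find_min' hne ⟨D', rfl⟩
    refine ⟨D, ?_⟩
    have h1 := hC₂ W hss q hq hq2 hqN D hmin
    have h2 := hC₁ W hss q hq hq2 hqN
    have h3 := hA W hss q hq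
    -- abbreviations
    set N : ℝ := (W.conductorNorm ℤ : ℝ) with hNdef
    set ξ : ℝ := (Literature.NumberTheory.Automorphic.brandtXi (W.conductorNorm ℤ / q) q
      (fun n => W.LFunction n) : ℝ) with hξ
    set v : ℝ := (((W.minimalDiscriminantNorm ℤ).factorization q : ℕ) : ℝ) with hv
    have hξ0 : 0 ≤ ξ := by rw [hξ]; exact Nat.cast_nonneg _
    have hv0 : 0 ≤ v := by rw [hv]; exact Nat.cast_nonneg _
    have hNa : 0 ≤ N ^ (ε / 3) := Real.rpow_nonneg hN0.le _
    have hNb : 0 ≤ N ^ (2 + ε / 3) := Real.rpow_nonneg hN0.le _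
    -- v ≤ max A 0 · (3/ε + 1) · N^{ε/3}
    have hlog1 : (1 : ℝ) ≤ Real.log q := one_le_log_of_odd_prime hq hq2
    have hlogN : 0 ≤ Real.log N := Real.log_nonneg hN1
    have hv1 : v ≤ max A 0 * ((3 / ε + 1) * N ^ (ε / 3)) := by
      calc v ≤ v * Real.log q := le_mul_of_one_le_right hv0 hlog1
        _ ≤ A * Real.log N + A := h3
        _ ≤ max A 0 * Real.log N + max A 0 :=
            add_le_add (mul_le_mul_of_nonneg_right (le_max_left _ _) hlogN) (le_max_left _ _)
        _ = max A 0 * (Real.log N + 1) := by ring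
        _ ≤ max A 0 * ((3 / ε + 1) * N ^ (ε / 3)) :=
            mul_le_mul_of_nonneg_left (log_add_one_le hN1 hε) (le_max_right _ _)
    -- ξ ≤ max C₁ 0 · N^{2+ε/3}
    have hξ1 : ξ ≤ max C₁ 0 * N ^ (2 + ε / 3) :=
      h2.trans (mul_le_mul_of_nonneg_right (le_max_left _ _) hNb)
    -- exponents
    have hexp : N ^ (ε / 3) * (N ^ (2 + ε / 3) * N ^ (ε / 3)) = N ^ (2 + ε) := by
      rw [← Real.rpow_add hN0, ← Real.rpow_add hN0]
      ring_nf
    calc (D.modularDegree : ℝ) ≤ C₂ * N ^ (ε / 3) * (ξ * v) := h1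
      _ = C₂ * (N ^ (ε / 3) * (ξ * v)) := by ring
      _ ≤ max C₂ 0 * (N ^ (ε / 3) * (ξ * v)) :=
          mul_le_mul_of_nonneg_right (le_max_left _ _) (by positivity)
      _ ≤ max C₂ 0 * (N ^ (ε / 3) * ((max C₁ 0 * N ^ (2 + ε / 3)) *
            (max A 0 * ((3 / ε + 1) * N ^ (ε / 3))))) :=
          mul_le_mul_of_nonneg_left
            (mul_le_mul_of_nonneg_left (mul_le_mul hξ1 hv1 hv0 (le_trans hξ0 hξ1)) hNa)
            (le_max_right _ _)
      _ = K * (N ^ (ε / 3) * (N ^ (2 + ε / 3) * N ^ (ε / 3))) := by rw [hK]; ring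
      _ = K * N ^ (2 + ε) := by rw [hexp]
      _ ≤ max (max C₀ 0 * (2 : ℝ) ^ |κ|) K * N ^ (2 + ε) :=
          mul_le_mul_of_nonneg_right hCle (Real.rpow_nonneg hN0.le _)
  · -- no odd prime divides N: N ≤ 2, use the Poly datum
    push_neg at hodd
    have hle2 : W.conductorNorm ℤ ≤ 2 :=
      conductorNorm_le_two_of_forall W hss (fun q hq hqN => by
        by_contra h; exact hodd q hq h hqN)
    have hN2 : (W.conductorNorm ℤ : ℝ) ≤ 2 := by exact_mod_cast hle2
    refine ⟨D₀, hD₀.trans ?_⟩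
    calc C₀ * (W.conductorNorm ℤ : ℝ) ^ κ ≤ max C₀ 0 * (W.conductorNorm ℤ : ℝ) ^ κ :=
          mul_le_mul_of_nonneg_right (le_max_left _ _) (Real.rpow_nonneg hN0.le _)
      _ ≤ max C₀ 0 * (2 : ℝ) ^ |κ| :=
          mul_le_mul_of_nonneg_left (rpow_le_two_rpow_abs hN1 hN2 κ) (le_max_right _ _)
      _ ≤ max (max C₀ 0 * (2 : ℝ) ^ |κ|) K := le_max_left _ _
      _ ≤ max (max C₀ 0 * (2 : ℝ) ^ |κ|) K * (W.conductorNorm ℤ : ℝ) ^ (2 + ε) :=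
          le_mul_of_one_le_right hC0 hNε

end Summit.ABC.ABC.Cruxes.SharpDegreeOfPolyDegree.Sketch
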